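import Literature.Computability.Cryptography.ChenQuantumLWERobustMeasurement
import Literature.Computability.Cryptography.ChenQuantumLWEChirpBasis
import Literature.InformationTheory.StateDiscrimination.PureStateHelstromBound
import Mathlib.Algebra.Order.Ring.Pow
import HarnessLib

/-!
# Barrier: sample-and-query access versus quantum-state inputs (Cotler–Huang–McClean 2021, §3)

Cotler, Huang, McClean, *Revisiting dequantization and quantum advantage in learning tasks*,
arXiv:2112.00811 (2021), **§3 "Exponential separation for a toy problem"** (held text p. 5):

> **Definition 3 (Minus sign search problem).** Fix a constant `C = O(1)` and let `d = 2ⁿ`. Consider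
> `x_1, …, x_C ∈ ℂ^d`, where one of the vectors `x_{k*}` is `(−1/√d, 1/√d, …, 1/√d)` and the rest are
> `(1/√d, …, 1/√d)`. The goal is to output the vector `x_{k*}`.
> **Proposition 1.** A classical algorithm with SQ access to the set of vectors `x_1, …, x_C` can solve
> the minus sign search problem in constant time. (*Proof.* Query the first components.)
> **Proposition 2.** Any quantum algorithm that can access copies of `|x_1⟩, …, |x_C⟩` requires
> `Ω(2ⁿ)`-time to solve the minus sign search problem. (*Proof.* `C = 2`; an algorithm using `N_1`,
> `N_2` copies distinguishes `|x*⟩⟨x*|^{⊗N_1} ⊗ |x⟩⟨x|^{⊗N_2}` from `|x⟩⟨x|^{⊗N_1} ⊗ |x*⟩⟨x*|^{⊗N_2}`;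
> with `N = max(N_1, N_2)` it is strictly easier to distinguish the states with `N` copies of each; by
> two-state discrimination the overlap `(1 − 2/d)` per copy forces `N ≥ Ω(2ⁿ)`.)

This is the paper's own illustration of its thesis (abstract): "classical algorithms with sample and
query (SQ) access can accomplish some learning tasks exponentially faster than quantum algorithms with
quantum state inputs … SQ access can sometimes be significantly more powerful than quantum state
inputs … when comparing … we must make the comparison within the same input model."

**Structured barrier block (D-0021).**
* `technique_class:` transferring a conclusion between the two input models of the dequantization
  literature — SQ (sample-and-query) access to classical vectors/matrices versus copies of the
  amplitude-encoded quantum states `|x⟩` — in either direction, as if they were interchangeable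
  ("dequantized ⇒ no quantum advantage on quantum data", or "hard with state inputs ⇒ classically hard").
  [cite: CotlerHuangMcclean2021, abstract and §1]
* `blocks:` reading an SQ-model dequantization (Tang 2019; Chia et al. 2022 — CLAIMS A-01/A-03/A-04
  of cell pub-qadeq) as a statement about learners that receive quantum states (the QML-on-quantum-data
  rows), and conversely reading copy-complexity lower bounds for state inputs as classical hardness: the
  two models are provably incomparable on explicit tasks (Props. 1–2 below, proved; Thm 1 of the paper
  for far-apart states). [cite: CotlerHuangMcclean2021, §3 Props. 1–2, §4 Thm 1]
* `because:` the minus-sign search problem is solved by ONE classical query (Prop. 1) while any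
  measurement on `N` copies of each state that names the marked vector with probability `≥ 1 − ε` on
  both arrangements forces `(1 − 2/d)^{4N} ≤ 4ε`, hence `N ≥ d(1 − 4ε)/8 = Ω(2ⁿ)` copies (Prop. 2; here
  via the tree's two-state bound `POVM.norm_sq_dotProduct_le_of_almostCertain`, constant `4ε`; the
  Helstrom-sharp `4ε(1 − ε)` is `minusSign_overlap_le_helstrom`).
  [cite: CotlerHuangMcclean2021, §3 proof of Prop. 2];
  [cite: NielsenChuang2010, Box 2.3 p. 87]
* `evasions_known:` compare within ONE input model: the paper's §5 proposes classical algorithms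
  with access to MEASUREMENT DATA of the quantum states as the fair classical counterpart of
  quantum-state inputs ("none needed" for claims that already fix the input model, as every
  adjudication of cell pub-qadeq does). [cite: CotlerHuangMcclean2021, §5]
* `scope_caveats:` formalized here: the TOY problem of §3 only (states exponentially close), in the
  reduced form "`N` copies of each arrangement" that the printed proof passes to (`N = max(N_1, N_2)`),
  with the two-outcome read-out of an arbitrary POVM as the algorithm model and the discrimination
  constant `4ε` / Helstrom's `4ε(1 − ε)` (same `Ω(d)` conclusion); NOT formalized: §4 Thm 1 (real-vector
  search, Haar-random far-apart states, `Ω(2^{n/2})`), §5's positive proposals; "time" is read as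
  "number of copies consumed" (a lower bound on time). [cite: CotlerHuangMcclean2021, §3–§4]
* `status:` established (the proofs are two-state discrimination; no dissent located).

Everything below is PROVED (no named fact): `plusVec`/`minusVec` (Def. 3), `prodState` and its
inner-product rule, the two `N+N`-copy arrangements `arrangement₁/₂`, `minusSign_classical_one_query`
(Prop. 1), `minusSign_overlap_le` (Prop. 2, quantitative: `(1 − 2/d)^{4N} ≤ 4ε`) and
`minusSign_copies_lower_bound` (`d(1 − 4ε) ≤ 8N`).

## References
* [CotlerHuangMcclean2021] J. Cotler, H.-Y. Huang, J. R. McClean, *Revisiting dequantization and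
  quantum advantage in learning tasks*, arXiv:2112.00811 (2021), §3 Def. 3, Props. 1–2 (p. 5).
* [NielsenChuang2010] M. A. Nielsen, I. L. Chuang, *Quantum Computation and Quantum Information*,
  CUP 2010, §2.2.6 (POVMs), Box 2.3 — via `Literature.Computability.Cryptography.Chen2024.POVM`.
-/

noncomputable section

open scoped BigOperators ComplexOrder
open Finset Matrix

namespace Literature.Barriers.QuantumAdvantage

namespace SQvsStateInputs

open Literature.Computability.Cryptography.Chen2024

/-! ### Definition 3: the two candidate vectors -/

/-- `x = (1/√d, …, 1/√d) ∈ ℂ^d`. [cite: CotlerHuangMcclean2021, §3 Def. 3] -/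
def plusVec (d : ℕ) : Fin d → ℂ := fun _ => ((1 / Real.sqrt d : ℝ) : ℂ)

/-- `x* = (−1/√d, 1/√d, …, 1/√d) ∈ ℂ^d` — the vector "which has a component with a minus sign".
[cite: CotlerHuangMcclean2021, §3 Def. 3] -/
def minusVec (d : ℕ) : Fin d → ℂ :=
  fun i => if i.val = 0 then -((1 / Real.sqrt d : ℝ) : ℂ) else ((1 / Real.sqrt d : ℝ) : ℂ)

variable {d : ℕ}

/-- `(1/√d)·(1/√d) = 1/d` in `ℂ`. `[folklore]` (private plumbing) -/
private theorem sqrt_sq_inv (hd : 0 < d) : ((1 / Real.sqrt d : ℝ) : ℂ) * ((1 / Real.sqrt d : ℝ) : ℂ) = (1 / d : ℝ) := by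
  rw [← Complex.ofReal_mul]
  congr 1
  have h : (0 : ℝ) < d := Nat.cast_pos.2 hd
  rw [div_mul_div_comm, one_mul, Real.mul_self_sqrt h.le]

/-- `‖x‖² = 1`. [cite: CotlerHuangMcclean2021, §3 Def. 3] -/
theorem star_plusVec_dot_plusVec (hd : 0 < d) : star (plusVec d) ⬝ᵥ plusVec d = 1 := by
  unfold plusVec dotProduct
  simp only [Pi.star_apply, Complex.star_def, Complex.conj_ofReal]
  rw [sqrt_sq_inv hd, sum_const, card_univ, Fintype.card_fin, nsmul_eq_mul, Complex.ofReal_div,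
    Complex.ofReal_one, Complex.ofReal_natCast, mul_one_div_cancel (Nat.cast_ne_zero.2 hd.ne')]

/-- `‖x*‖² = 1`. [cite: CotlerHuangMcclean2021, §3 Def. 3] -/
theorem star_minusVec_dot_minusVec (hd : 0 < d) : star (minusVec d) ⬝ᵥ minusVec d = 1 := by
  have hterm : ∀ i : Fin d, star (minusVec d i) * minusVec d i = (1 / d : ℝ) := by
    intro i
    unfold minusVec
    split_ifs <;> simp only [star_neg, Complex.star_def, Complex.conj_ofReal, neg_mul_neg] <;>
      exact sqrt_sq_inv hd
  unfold dotProduct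
  simp only [Pi.star_apply, hterm, sum_const, card_univ, Fintype.card_fin, nsmul_eq_mul,
    Complex.ofReal_div, Complex.ofReal_one, Complex.ofReal_natCast]
  exact mul_one_div_cancel (Nat.cast_ne_zero.2 hd.ne')

/-- `⟨x*, x⟩ = 1 − 2/d` ("the overlap between `|x*⟩` and any `|x_i⟩` for `i ≠ k*` is `1 − 2/d`").
[cite: CotlerHuangMcclean2021, §3 (text before Lemma 1)] -/
theorem star_minusVec_dot_plusVec (hd : 0 < d) :
    star (minusVec d) ⬝ᵥ plusVec d = ((1 - 2 / d : ℝ) : ℂ) := by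
  classical
  have h0 : (⟨0, hd⟩ : Fin d) ∈ univ := mem_univ _
  unfold dotProduct
  rw [← Finset.add_sum_erase _ _ h0]
  have hrest : ∀ i ∈ univ.erase (⟨0, hd⟩ : Fin d), star (minusVec d) i * plusVec d i = (1 / d : ℝ) := by
    intro i hi
    have hi0 : i.val ≠ 0 := fun h => (mem_erase.1 hi).1 (Fin.ext h)
    rw [Pi.star_apply]
    unfold minusVec plusVec
    simp only [hi0, if_false, Complex.star_def, Complex.conj_ofReal]
    exact sqrt_sq_inv hd
  have hfirst : star (minusVec d) ⟨0, hd⟩ * plusVec d ⟨0, hd⟩ = -((1 / d : ℝ) : ℂ) := by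
    rw [Pi.star_apply]
    unfold minusVec plusVec
    simp only [if_true, star_neg, Complex.star_def, Complex.conj_ofReal, neg_mul]
    rw [sqrt_sq_inv hd]
  rw [sum_congr rfl hrest, hfirst, sum_const, card_erase_of_mem h0, card_univ, Fintype.card_fin,
    nsmul_eq_mul]
  have hd' : (d : ℂ) ≠ 0 := Nat.cast_ne_zero.2 hd.ne'
  push_cast
  rw [Nat.cast_sub (Nat.one_le_iff_ne_zero.2 hd.ne')]
  field_simp
  push_cast
  ring

/-- `⟨x, x*⟩ = 1 − 2/d`. [cite: CotlerHuangMcclean2021, §3] -/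
theorem star_plusVec_dot_minusVec (hd : 0 < d) :
    star (plusVec d) ⬝ᵥ minusVec d = ((1 - 2 / d : ℝ) : ℂ) := by
  have h := congrArg star (star_minusVec_dot_plusVec hd)
  rw [star_dotProduct, star_star, Complex.star_def, Complex.conj_ofReal] at h
  rw [← h, dotProduct_comm]

/-! ### Proposition 1: one classical query finds the minus sign -/

/-- **Proposition 1** (classical, SQ access): the first component of `x*` is negative and that of `x`
is positive, so "the classical algorithm simply performs Query(1) on the first components of each of
the `x_i`'s, and checks which one is negative" — constant time. [cite: CotlerHuangMcclean2021, §3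
Prop. 1] -/
theorem minusSign_classical_one_query (hd : 0 < d) :
    (minusVec d ⟨0, hd⟩).re < 0 ∧ 0 < (plusVec d ⟨0, hd⟩).re := by
  have hpos : 0 < 1 / Real.sqrt d := one_div_pos.2 (Real.sqrt_pos.2 (Nat.cast_pos.2 hd))
  unfold minusVec plusVec
  simp only [if_true, Complex.neg_re, Complex.ofReal_re]
  exact ⟨by linarith, hpos⟩

/-! ### Product states and their overlaps -/

/-- A product (tensor-power) state on the register `(T → Fin d)`: `|a⟩ = ⊗_t |a_t⟩`, amplitude
`∏_t a_t(i_t)` on the basis string `i`. [cite: CotlerHuangMcclean2021, §3 proof of Prop. 2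
(`|x*⟩⟨x*|^{⊗N} ⊗ |x⟩⟨x|^{⊗N}`)] -/
def prodState {T : Type*} [Fintype T] (a : T → Fin d → ℂ) : (T → Fin d) → ℂ := fun i => ∏ t, a t (i t)

/-- Overlaps of product states multiply: `⟨⊗a_t, ⊗b_t⟩ = ∏_t ⟨a_t, b_t⟩`.
[cite: CotlerHuangMcclean2021, §3 proof of Prop. 2 (overlap `(1 − 2/d)` per copy)] -/
theorem star_prodState_dot_prodState {T : Type*} [Fintype T] [DecidableEq T] (a b : T → Fin d → ℂ) :
    star (prodState a) ⬝ᵥ prodState b = ∏ t, (star (a t) ⬝ᵥ b t) := by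
  unfold prodState dotProduct
  simp only [Pi.star_apply, star_prod, ← prod_mul_distrib]
  rw [Finset.prod_univ_sum (fun _ => (univ : Finset (Fin d))) (fun t j => star (a t j) * b t j),
    Fintype.piFinset_univ]

/-- Arrangement 1 (`x_1 = x*`, `x_2 = x`) presented with `N` copies of each: the state
`|x*⟩^{⊗N} ⊗ |x⟩^{⊗N}` on `2N` registers. [cite: CotlerHuangMcclean2021, §3 proof of Prop. 2] -/
def arrangement₁ (d N : ℕ) : ((Fin N ⊕ Fin N) → Fin d) → ℂ :=
  prodState (Sum.elim (fun _ => minusVec d) (fun _ => plusVec d))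

/-- Arrangement 2 (`x_1 = x`, `x_2 = x*`): `|x⟩^{⊗N} ⊗ |x*⟩^{⊗N}`. [cite: CotlerHuangMcclean2021, §3
proof of Prop. 2] -/
def arrangement₂ (d N : ℕ) : ((Fin N ⊕ Fin N) → Fin d) → ℂ :=
  prodState (Sum.elim (fun _ => plusVec d) (fun _ => minusVec d))

variable {N : ℕ}

/-- `⟨arr₁, arr₁⟩ = 1`. [cite: CotlerHuangMcclean2021, §3 proof of Prop. 2] -/
theorem arrangement₁_normSq (hd : 0 < d) : star (arrangement₁ d N) ⬝ᵥ arrangement₁ d N = 1 := by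
  unfold arrangement₁
  rw [star_prodState_dot_prodState, Fintype.prod_sum_type]
  simp [star_minusVec_dot_minusVec hd, star_plusVec_dot_plusVec hd]

/-- `⟨arr₂, arr₂⟩ = 1`. [cite: CotlerHuangMcclean2021, §3 proof of Prop. 2] -/
theorem arrangement₂_normSq (hd : 0 < d) : star (arrangement₂ d N) ⬝ᵥ arrangement₂ d N = 1 := by
  unfold arrangement₂
  rw [star_prodState_dot_prodState, Fintype.prod_sum_type]
  simp [star_minusVec_dot_minusVec hd, star_plusVec_dot_plusVec hd]

/-- **The overlap of the two arrangements is `(1 − 2/d)^{2N}`** (`N` factors `⟨x*,x⟩` and `N` factors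
`⟨x,x*⟩`). [cite: CotlerHuangMcclean2021, §3 proof of Prop. 2 (display)] -/
theorem arrangement_overlap (hd : 0 < d) :
    star (arrangement₁ d N) ⬝ᵥ arrangement₂ d N = (((1 - 2 / d : ℝ) ^ (2 * N) : ℝ) : ℂ) := by
  unfold arrangement₁ arrangement₂
  rw [star_prodState_dot_prodState, Fintype.prod_sum_type]
  simp only [Sum.elim_inl, Sum.elim_inr, star_minusVec_dot_plusVec hd, star_plusVec_dot_minusVec hd,
    prod_const, card_univ, Fintype.card_fin]
  push_cast
  ring

/-! ### Proposition 2: copies lower bound for any measurement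

**Note on the printed display (referee R-SQSI-1).** The proof of Prop. 2 prints (held text p. 5,
L36–38): "if we want to distinguish with probability at least `0.9`, then we require
`‖ |x*⟩⟨x*|^{⊗N} ⊗ |x⟩⟨x|^{⊗N} − |x⟩⟨x|^{⊗N} ⊗ |x*⟩⟨x*|^{⊗N} ‖₁ = (1 − 2/d)^{4N} ≥ 0.8`, which implies
`N ≥ Ω(2ⁿ)`."  Read literally this display is a slip: `(1 − 2/d)^{4N}` is the SQUARED OVERLAP
`|⟨arr₁, arr₂⟩|²` of the two (pure) arrangement states, not their trace-norm distance (which is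
`2·√(1 − (1 − 2/d)^{4N})`), and reliable discrimination forces the overlap to be SMALL, not large.
What success probability `≥ 1 − ε` on both arrangements actually implies is the upper bound
`(1 − 2/d)^{4N} ≤ 4ε(1 − ε)` (Helstrom; `≤ 0.36` at `ε = 1/10`), weakened to `≤ 4ε` in
`minusSign_overlap_le`.  The theorems below formalise this CORRECTED inequality, not the display as
printed; the conclusion `N = Ω(2ⁿ)` of Prop. 2 is unaffected (`minusSign_copies_lower_bound`). -/

/-- A quantum algorithm for the (two-candidate) minus-sign search problem with `N` copies of each
input state: an arbitrary POVM `E` on the `2N` registers followed by a classical read-out `dec` of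
the answer "is `x_1` the marked vector?"; it SOLVES the problem with error `ε` if the correct answer
has probability `≥ 1 − ε` on both arrangements. [cite: CotlerHuangMcclean2021, §3 Def. 3 and proof
of Prop. 2 ("if the quantum algorithm solves the minus sign distinction problem, then it can
distinguish between" the two arrangement states)] -/
def SolvesMinusSign {κ : Type*} [Fintype κ] (d N : ℕ) (ε : ℝ) (E : POVM ((Fin N ⊕ Fin N) → Fin d) κ)
    (dec : κ → Bool) : Prop :=
  (E.map dec).AlmostCertain ε (arrangement₁ d N) true ∧
    (E.map dec).AlmostCertain ε (arrangement₂ d N) false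

/-- **Proposition 2, quantitative core.** If a measurement on `N` copies of each state solves the
minus-sign search problem with error `ε`, then `(1 − 2/d)^{4N} ≤ 4ε` — two-state discrimination applied
to the arrangement states, whose overlap is `(1 − 2/d)^{2N}` (the corrected form of the printed display
`‖…‖₁ = (1 − 2/d)^{4N} ≥ 0.8`; see the note opening this section).
[cite: CotlerHuangMcclean2021, §3 Prop. 2 (proof: Lemma 1 applied to the `N`-copy arrangements)];
[cite: NielsenChuang2010, Box 2.3 p. 87] -/
theorem minusSign_overlap_le {κ : Type*} [Fintype κ] (hd : 0 < d) {ε : ℝ}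
    {E : POVM ((Fin N ⊕ Fin N) → Fin d) κ} {dec : κ → Bool} (h : SolvesMinusSign d N ε E dec) :
    (1 - 2 / (d : ℝ)) ^ (4 * N) ≤ 4 * ε := by
  classical
  have key := (E.map dec).norm_sq_dotProduct_le_of_almostCertain h.1 h.2 (by decide)
  rw [arrangement_overlap hd, arrangement₁_normSq hd, arrangement₂_normSq hd, Complex.norm_real,
    Real.norm_eq_abs, sq_abs, Complex.one_re, mul_one, mul_one] at key
  calc (1 - 2 / (d : ℝ)) ^ (4 * N) = ((1 - 2 / (d : ℝ)) ^ (2 * N)) ^ 2 := by rw [← pow_mul]; ring_nf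
    _ ≤ 4 * ε := key

/-- **Proposition 2 (copies lower bound).** Any measurement on `N` copies of each state that solves the
minus-sign search problem with error `ε` uses `N ≥ d(1 − 4ε)/8` copies — for the paper's success
probability `0.9` (`ε = 1/10`), `N ≥ 3d/40 = Ω(2ⁿ)`; reading the copies alone takes that much time
("requires `Ω(2ⁿ)`-time"). From `(1 − 2/d)^{4N} ≥ 1 − 8N/d` (Bernoulli) and the previous bound.
[cite: CotlerHuangMcclean2021, §3 Prop. 2 ("which implies `N ≥ Ω(2ⁿ)` … the time complexity of the
quantum algorithm is likewise lower bounded by `Ω(2ⁿ)`")] -/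
theorem minusSign_copies_lower_bound {κ : Type*} [Fintype κ] (hd : 0 < d) {ε : ℝ}
    {E : POVM ((Fin N ⊕ Fin N) → Fin d) κ} {dec : κ → Bool} (h : SolvesMinusSign d N ε E dec) :
    (d : ℝ) * (1 - 4 * ε) ≤ 8 * N := by
  have hle := minusSign_overlap_le hd h
  have hdpos : (0 : ℝ) < d := Nat.cast_pos.2 hd
  -- Bernoulli: `1 + (4N)(−2/d) ≤ (1 − 2/d)^{4N}`
  have hB := one_add_mul_le_pow (show (-2 : ℝ) ≤ -(2 / d) by
    have : (2 : ℝ) / d ≤ 2 := by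
      rw [div_le_iff₀ hdpos]
      have : (1 : ℝ) ≤ d := Nat.one_le_cast.2 hd
      linarith
    linarith) (4 * N)
  rw [← sub_eq_add_neg] at hB
  have h1 : 1 + (4 * N : ℕ) * (-(2 / (d : ℝ))) ≤ 4 * ε := by
    have : (1 : ℝ) + (4 * N : ℕ) * (-(2 / (d : ℝ))) = 1 + ↑(4 * N) * -(2 / ↑d) := rfl
    linarith [hB, hle]
  push_cast at h1
  -- `1 − 8N/d ≤ 4ε` ⇒ `d(1 − 4ε) ≤ 8N`
  have h2 : (d : ℝ) * (1 - 4 * ε) ≤ (d : ℝ) * (8 * N / d) := by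
    refine mul_le_mul_of_nonneg_left ?_ hdpos.le
    have : (8 : ℝ) * N / d = -(4 * (N : ℝ) * -(2 / d)) := by ring
    linarith
  calc (d : ℝ) * (1 - 4 * ε) ≤ (d : ℝ) * (8 * N / d) := h2
    _ = 8 * N := by field_simp

/-! ### Sharpening by the Helstrom bound (optimal two-state constant) -/

/-- **Proposition 2 with the optimal two-state constant.** Any measurement on `N` copies of each
arrangement that answers the minus-sign search problem with error `ε ≤ 1/2` on both forces
`(1 − 2/d)^{4N} ≤ 4ε(1 − ε)` — the Helstrom-sharp form of `minusSign_overlap_le` (which has `4ε`),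
via `PureStateHelstromBound.povm_norm_sq_dotProduct_le_helstrom` (Barnett 2009 §4.4 (4.55)–(4.58)).
[cite: CotlerHuangMcclean2021, §3 Prop. 2 (proof: "the states … have overlap … so distinguishing them
requires …")]; [cite: Barnett2009, §4.4 eqs. (4.55)–(4.58)] -/
theorem minusSign_overlap_le_helstrom {κ : Type*} [Fintype κ] (hd : 0 < d) {ε : ℝ} (hε : ε ≤ 1 / 2)
    {E : POVM ((Fin N ⊕ Fin N) → Fin d) κ} {dec : κ → Bool} (h : SolvesMinusSign d N ε E dec) :
    (1 - 2 / (d : ℝ)) ^ (4 * N) ≤ 4 * ε * (1 - ε) := by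
  classical
  have key := Literature.InformationTheory.StateDiscrimination.PureStateHelstromBound.povm_norm_sq_dotProduct_le_helstrom
    (E.map dec) hε (arrangement₁_normSq (N := N) hd) (arrangement₂_normSq (N := N) hd) h.1 h.2
    (by decide)
  rw [arrangement_overlap hd, Complex.norm_real, Real.norm_eq_abs, sq_abs] at key
  calc (1 - 2 / (d : ℝ)) ^ (4 * N) = ((1 - 2 / (d : ℝ)) ^ (2 * N)) ^ 2 := by rw [← pow_mul]; ring_nf
    _ ≤ 4 * ε * (1 - ε) := key

end SQvsStateInputs

end Literature.Barriers.QuantumAdvantage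

end
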